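import Summits.AtomisticToContinuum.BoseEinsteinCondensation.Theorems.BECHusimiAmplitudeGasHusimiConcentrationBargmann

/-!
# Bargmann orthogonality, II: the two Gaussian identities for symmetric antiholomorphic forms

Helper file for route `BECHusimiAmplitudeGas`, support item `HusimiConcentration`
(stmt-AtomisticToContinuum-11994). For the antiholomorphic form
`P(c) = ∑_{f : Fin m → ι} (∏ⱼ conj c_{f j}) A_f` with SYMMETRIC coefficients
(`A (f ∘ σ) = A f`, as for the coefficients `A_f = ⟨e_{f 1} ⊗ ⋯ ⊗ e_{f m}, Ψ⟩` of a bosonic `Ψ`)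
and the Gaussian weight `e^{-q}`, `q(c) = ∑ᵢ ‖cᵢ‖²`:

* `integral_gauss_norm_sq_form`: `∫ e^{-q} |P|² = π^{|ι|} m! ∑_f |A_f|²`
  (the Gaussian mass of `P` is `m!` times the `ℓ²`-norm of its coefficient tensor);
* `integral_gauss_norm_sq_apply_mul_norm_sq_form`:
  `∫ e^{-q} |c_{i₀}|² |P|² = π^{|ι|} m! ∑_f (1 + α_{i₀}(f)) |A_f|²`, `α_{i₀}(f) = #{j | f j = i₀}`
  (multiplying by `conj c_{i₀}` raises the occupation of mode `i₀` by one).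

Their quotient is the route's "exact identity"
`E_w[|⟨u_c,φ₀⟩|²|F|²] / E_w|F|² = 1 + n₀(Φ)/‖Φ‖²` for `Φ = ∑_f A_f e_f` (the all-slow component),
since `n₀(Φ) = ∑_f α_{i₀}(f)|A_f|²` and `‖Φ‖² = ∑_f |A_f|²`.
-/

noncomputable section

open MeasureTheory Set
open scoped ENNReal NNReal ComplexConjugate

namespace Summit.AtomisticToContinuum.BoseEinsteinCondensation.Theorems.BargmannIdentity

open Summit.AtomisticToContinuum.BoseEinsteinCondensation.Theorems.LaplaceCapUnion

variable {ι : Type*} [Fintype ι] [DecidableEq ι]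

/-! ### Raising the occupation of one mode: `f ↦ (i₀, f)` -/

omit [Fintype ι] in
/-- Prepending the mode `i₀` raises its occupation number by one and leaves the others:
`#{j | (i₀ :: f) j = i} = [i₀ = i] + #{j | f j = i}`. [folklore] -/
theorem card_filter_cons_eq {m : ℕ} (i₀ : ι) (f : Fin m → ι) (i : ι) :
    (Finset.univ.filter fun j : Fin (m + 1) => (Fin.cons i₀ f : Fin (m + 1) → ι) j = i).card =
      (if i₀ = i then 1 else 0) + (Finset.univ.filter fun j => f j = i).card := by
  rw [Finset.card_filter, Finset.card_filter, Fin.sum_univ_succ]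
  simp only [Fin.cons_zero, Fin.cons_succ]

omit [Fintype ι] in
/-- Prepending the same mode to `f` and `g` does not change whether their occupation numbers
agree. [folklore] -/
theorem occ_cons_eq_iff {m : ℕ} (i₀ : ι) (f g : Fin m → ι) :
    ((fun i => (Finset.univ.filter fun j : Fin (m + 1) =>
        (Fin.cons i₀ f : Fin (m + 1) → ι) j = i).card) =
      fun i => (Finset.univ.filter fun j : Fin (m + 1) =>
        (Fin.cons i₀ g : Fin (m + 1) → ι) j = i).card) ↔
    ((fun i => (Finset.univ.filter fun j => f j = i).card) =
      fun i => (Finset.univ.filter fun j => g j = i).card) := by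
  simp only [card_filter_cons_eq, funext_iff, add_right_inj]

/-- `∏ᵢ αᵢ(i₀ :: f)! = (α_{i₀}(f) + 1) ∏ᵢ αᵢ(f)!`. [folklore] -/
theorem prod_factorial_occ_cons {m : ℕ} (i₀ : ι) (f : Fin m → ι) :
    ∏ i, ((Finset.univ.filter fun j : Fin (m + 1) =>
        (Fin.cons i₀ f : Fin (m + 1) → ι) j = i).card.factorial : ℝ) =
      (((Finset.univ.filter fun j => f j = i₀).card : ℝ) + 1) *
        ∏ i, ((Finset.univ.filter fun j => f j = i).card.factorial : ℝ) := by
  simp_rw [card_filter_cons_eq]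
  have hpt : ∀ i, (((if i₀ = i then 1 else 0) + (Finset.univ.filter fun j => f j = i).card).factorial : ℝ) =
      (if i₀ = i then (((Finset.univ.filter fun j => f j = i₀).card : ℝ) + 1) else 1) *
        ((Finset.univ.filter fun j => f j = i).card.factorial : ℝ) := by
    intro i
    by_cases h : i₀ = i
    · subst h
      rw [if_pos rfl, if_pos rfl, add_comm, Nat.factorial_succ]
      push_cast
      ring
    · rw [if_neg h, if_neg h, zero_add, one_mul]
  simp_rw [hpt]
  rw [Finset.prod_mul_distrib, Finset.prod_ite_eq]
  simp

/-- **Pairing after raising mode `i₀`**: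
`∫ e^{-q} conj(c)^{i₀::f} c^{i₀::g} = (α_{i₀}(f) + 1) ∫ e^{-q} conj(c)^f c^g`. [folklore] -/
theorem pairing_cons {m : ℕ} (i₀ : ι) (f g : Fin m → ι) :
    ∫ c : ι → ℂ, (Real.exp (-(∑ i, ‖c i‖ ^ 2)) : ℂ) *
        ((∏ j : Fin (m + 1), conj (c ((Fin.cons i₀ f : Fin (m + 1) → ι) j))) *
          ∏ j : Fin (m + 1), c ((Fin.cons i₀ g : Fin (m + 1) → ι) j)) =
      ((((Finset.univ.filter fun j => f j = i₀).card : ℝ) + 1 : ℝ) : ℂ) *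
        ∫ c : ι → ℂ, (Real.exp (-(∑ i, ‖c i‖ ^ 2)) : ℂ) *
          ((∏ j, conj (c (f j))) * ∏ j, c (g j)) := by
  rw [integral_gauss_prod_conj_mul_prod, integral_gauss_prod_conj_mul_prod]
  by_cases h : (fun i => (Finset.univ.filter fun j => f j = i).card) =
      fun i => (Finset.univ.filter fun j => g j = i).card
  · rw [if_pos ((occ_cons_eq_iff i₀ f g).2 h), if_pos h, prod_factorial_occ_cons, ← Complex.ofReal_mul]
    congr 1
    ring
  · rw [if_neg (fun h' => h ((occ_cons_eq_iff i₀ f g).1 h')), if_neg h, mul_zero]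

/-! ### Bilinear expansion against the Gaussian -/

omit [DecidableEq ι] in
/-- Each pairing term `e^{-q} conj(c)^f c^g` is integrable. [folklore] -/
theorem integrable_gauss_pairing_term {m : ℕ} (f g : Fin m → ι) :
    Integrable fun c : ι → ℂ => (Real.exp (-(∑ i, ‖c i‖ ^ 2)) : ℂ) *
      ((∏ j, conj (c (f j))) * ∏ j, c (g j)) := by
  refine integrable_gauss_mul_of_norm_le (Continuous.aestronglyMeasurable ?_) (m + m) 1 ?_
  · exact (continuous_finsetProd _ fun j _ => Complex.continuous_conj.comp (continuous_apply (f j))).mul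
      (continuous_finsetProd _ fun j _ => continuous_apply (g j))
  · intro c
    rw [norm_mul, one_mul, pow_add]
    exact mul_le_mul (norm_prod_conj_apply_le c f) (norm_prod_apply_le c g) (norm_nonneg _)
      (by positivity)

omit [DecidableEq ι] in
/-- **Bilinear expansion.** For finite families of monomials `conj(c)^{p k}`, `c^{r k'}` with
coefficients `a k`, `b k'`:
`∫ e^{-q} (∑_k conj(c)^{p k} a_k)(∑_{k'} c^{r k'} b_{k'}) = ∑_{k,k'} a_k b_{k'} ∫ e^{-q} conj(c)^{p k} c^{r k'}`.
[folklore] -/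
theorem integral_gauss_sum_mul_sum {κ : Type*} [Fintype κ] {m : ℕ} (p r : κ → (Fin m → ι))
    (a b : κ → ℂ) :
    ∫ c : ι → ℂ, (Real.exp (-(∑ i, ‖c i‖ ^ 2)) : ℂ) *
        ((∑ k, (∏ j, conj (c (p k j))) * a k) * ∑ k, (∏ j, c (r k j)) * b k) =
      ∑ k, ∑ k', (a k * b k') *
        ∫ c : ι → ℂ, (Real.exp (-(∑ i, ‖c i‖ ^ 2)) : ℂ) *
          ((∏ j, conj (c (p k j))) * ∏ j, c (r k' j)) := by
  have hpt : ∀ c : ι → ℂ, (Real.exp (-(∑ i, ‖c i‖ ^ 2)) : ℂ) *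
      ((∑ k, (∏ j, conj (c (p k j))) * a k) * ∑ k, (∏ j, c (r k j)) * b k) =
      ∑ k, ∑ k', (a k * b k') * ((Real.exp (-(∑ i, ‖c i‖ ^ 2)) : ℂ) *
        ((∏ j, conj (c (p k j))) * ∏ j, c (r k' j))) := by
    intro c
    rw [Finset.sum_mul_sum, Finset.mul_sum]
    refine Finset.sum_congr rfl fun k _ => ?_
    rw [Finset.mul_sum]
    refine Finset.sum_congr rfl fun k' _ => ?_
    ring
  simp_rw [hpt]
  rw [integral_finsetSum _ fun k _ => integrable_finsetSum _ fun k' _ =>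
    (integrable_gauss_pairing_term (p k) (r k')).const_mul _]
  refine Finset.sum_congr rfl fun k _ => ?_
  rw [integral_finsetSum _ fun k' _ => (integrable_gauss_pairing_term (p k) (r k')).const_mul _]
  refine Finset.sum_congr rfl fun k' _ => ?_
  exact integral_const_mul _ _

/-! ### The two identities -/

omit [DecidableEq ι] in
/-- `conj P(c) = ∑_g c^g conj(A g)`. [folklore] -/
theorem conj_form {m : ℕ} (A : (Fin m → ι) → ℂ) (c : ι → ℂ) :
    conj (∑ f : Fin m → ι, (∏ j, conj (c (f j))) * A f) =
      ∑ g : Fin m → ι, (∏ j, c (g j)) * conj (A g) := by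
  rw [map_sum]
  refine Finset.sum_congr rfl fun g _ => ?_
  rw [map_mul, map_prod]
  simp only [Complex.conj_conj]

/-- **First Bargmann identity.** For symmetric coefficients,
`∫ e^{-q(c)} |∑_f conj(c)^f A_f|² dc = π^{|ι|} m! ∑_f |A_f|²`. [folklore] -/
theorem integral_gauss_norm_sq_form {m : ℕ} (A : (Fin m → ι) → ℂ)
    (hA : ∀ (σ : Equiv.Perm (Fin m)) (f : Fin m → ι), A (f ∘ ⇑σ) = A f) :
    ∫ c : ι → ℂ, Real.exp (-(∑ i, ‖c i‖ ^ 2)) *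
        ‖∑ f : Fin m → ι, (∏ j, conj (c (f j))) * A f‖ ^ 2 =
      Real.pi ^ Fintype.card ι * m.factorial * ∑ f : Fin m → ι, ‖A f‖ ^ 2 := by
  apply Complex.ofReal_injective
  rw [← integral_complex_ofReal]
  have hpt : ∀ c : ι → ℂ, (((Real.exp (-(∑ i, ‖c i‖ ^ 2)) *
      ‖∑ f : Fin m → ι, (∏ j, conj (c (f j))) * A f‖ ^ 2 : ℝ)) : ℂ) =
      (Real.exp (-(∑ i, ‖c i‖ ^ 2)) : ℂ) *
        ((∑ f : Fin m → ι, (∏ j, conj (c (f j))) * A f) *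
          ∑ g : Fin m → ι, (∏ j, c (g j)) * conj (A g)) := by
    intro c
    rw [← conj_form, Complex.mul_conj', Complex.ofReal_mul]
    push_cast
    rfl
  simp_rw [hpt]
  rw [integral_gauss_sum_mul_sum (fun f => f) (fun g => g) A (fun g => conj (A g))]
  have hinner : ∀ f : Fin m → ι, ∑ g : Fin m → ι, (A f * conj (A g)) *
      ∫ c : ι → ℂ, (Real.exp (-(∑ i, ‖c i‖ ^ 2)) : ℂ) * ((∏ j, conj (c (f j))) * ∏ j, c (g j)) =
      A f * ((((Real.pi ^ Fintype.card ι * m.factorial : ℝ)) : ℂ) * conj (A f)) := by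
    intro f
    rw [← sum_conj_mul_pairing A hA f, Finset.mul_sum]
    refine Finset.sum_congr rfl fun g _ => ?_
    ring
  simp_rw [hinner]
  push_cast
  rw [Finset.mul_sum]
  refine Finset.sum_congr rfl fun f _ => ?_
  rw [← Complex.mul_conj']
  ring

/-- **Second Bargmann identity.** For symmetric coefficients and a mode `i₀`,
`∫ e^{-q(c)} |c_{i₀}|² |∑_f conj(c)^f A_f|² dc = π^{|ι|} m! ∑_f (α_{i₀}(f) + 1) |A_f|²`,
`α_{i₀}(f) = #{j | f j = i₀}`. [folklore] -/
theorem integral_gauss_norm_sq_apply_mul_norm_sq_form {m : ℕ} (i₀ : ι) (A : (Fin m → ι) → ℂ)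
    (hA : ∀ (σ : Equiv.Perm (Fin m)) (f : Fin m → ι), A (f ∘ ⇑σ) = A f) :
    ∫ c : ι → ℂ, Real.exp (-(∑ i, ‖c i‖ ^ 2)) *
        (‖c i₀‖ ^ 2 * ‖∑ f : Fin m → ι, (∏ j, conj (c (f j))) * A f‖ ^ 2) =
      Real.pi ^ Fintype.card ι * m.factorial *
        ∑ f : Fin m → ι, (((Finset.univ.filter fun j => f j = i₀).card : ℝ) + 1) * ‖A f‖ ^ 2 := by
  apply Complex.ofReal_injective
  rw [← integral_complex_ofReal]
  -- `conj(c_{i₀}) P(c)` and `c_{i₀} conj P(c)` as forms of degree `m + 1`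
  have hP : ∀ c : ι → ℂ, conj (c i₀) * ∑ f : Fin m → ι, (∏ j, conj (c (f j))) * A f =
      ∑ f : Fin m → ι, (∏ j : Fin (m + 1), conj (c ((Fin.cons i₀ f : Fin (m + 1) → ι) j))) * A f := by
    intro c
    rw [Finset.mul_sum]
    refine Finset.sum_congr rfl fun f _ => ?_
    rw [Fin.prod_univ_succ]
    simp only [Fin.cons_zero, Fin.cons_succ]
    ring
  have hQ : ∀ c : ι → ℂ, c i₀ * ∑ g : Fin m → ι, (∏ j, c (g j)) * conj (A g) =
      ∑ g : Fin m → ι, (∏ j : Fin (m + 1), c ((Fin.cons i₀ g : Fin (m + 1) → ι) j)) * conj (A g) := by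
    intro c
    rw [Finset.mul_sum]
    refine Finset.sum_congr rfl fun g _ => ?_
    rw [Fin.prod_univ_succ]
    simp only [Fin.cons_zero, Fin.cons_succ]
    ring
  have hpt : ∀ c : ι → ℂ, (((Real.exp (-(∑ i, ‖c i‖ ^ 2)) *
      (‖c i₀‖ ^ 2 * ‖∑ f : Fin m → ι, (∏ j, conj (c (f j))) * A f‖ ^ 2) : ℝ)) : ℂ) =
      (Real.exp (-(∑ i, ‖c i‖ ^ 2)) : ℂ) *
        ((∑ f : Fin m → ι, (∏ j : Fin (m + 1), conj (c ((Fin.cons i₀ f : Fin (m + 1) → ι) j))) * A f) *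
          ∑ g : Fin m → ι, (∏ j : Fin (m + 1), c ((Fin.cons i₀ g : Fin (m + 1) → ι) j)) * conj (A g)) := by
    intro c
    rw [← hP, ← hQ, ← conj_form]
    push_cast
    rw [← Complex.mul_conj' (∑ f : Fin m → ι, (∏ j, conj (c (f j))) * A f),
      ← Complex.conj_mul' (c i₀)]
    ring
  simp_rw [hpt]
  rw [integral_gauss_sum_mul_sum (fun f => (Fin.cons i₀ f : Fin (m + 1) → ι))
    (fun g => (Fin.cons i₀ g : Fin (m + 1) → ι)) A (fun g => conj (A g))]
  simp_rw [pairing_cons]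
  have hinner : ∀ f : Fin m → ι, ∑ g : Fin m → ι, (A f * conj (A g)) *
      (((((Finset.univ.filter fun j => f j = i₀).card : ℝ) + 1 : ℝ) : ℂ) *
        ∫ c : ι → ℂ, (Real.exp (-(∑ i, ‖c i‖ ^ 2)) : ℂ) * ((∏ j, conj (c (f j))) * ∏ j, c (g j))) =
      A f * ((((Finset.univ.filter fun j => f j = i₀).card : ℝ) + 1 : ℝ) : ℂ) *
        ((((Real.pi ^ Fintype.card ι * m.factorial : ℝ)) : ℂ) * conj (A f)) := by
    intro f
    rw [← sum_conj_mul_pairing A hA f, Finset.mul_sum]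
    refine Finset.sum_congr rfl fun g _ => ?_
    ring
  simp_rw [hinner]
  push_cast
  rw [Finset.mul_sum]
  refine Finset.sum_congr rfl fun f _ => ?_
  rw [← Complex.mul_conj']
  ring

end Summit.AtomisticToContinuum.BoseEinsteinCondensation.Theorems.BargmannIdentity
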